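import Mathlib
import Literature.Probability.LatticeModels.TorusFourierProofs
import HarnessLib

/-!
# Weighted `ℓ¹` norms of inverse torus Fourier transforms: product ↦ convolution, submultiplicative moment weights,
# linear combinations, and the cosine (real-part) coefficients

Topic `Probability/LatticeModels`; sequel of `TorusFourier`/`TorusFourierProofs` (characters `χ_k(x)`, `torusFourierInv g x =
L^{-d} Σ_k g(k) χ_k(x)`, orthogonality).  For the position-space MOMENTS of momentum-space data on the discrete torus `(ℤ/Lℤ)^d`
(cell gate-hubbard-kl, K3 engine-flow child, the frame-RESPONSE door of the two-leg reading in JET form: moments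
`Σ_x w(x)·|f̌(x)|` of a two-leg kernel `f(k⃗)` control the derivatives of its trigonometric interpolant, and Polchinski's equation
produces PRODUCTS `ṡ(k⃗)·𝒲₂(k⃗)²` and LINEAR COMBINATIONS `Σ_A Ċ(A)·𝒲₄(k⃗; A)` of such data — Benfatto–Giuliani–Mastropietro 2006,
§2.1 (2.36aa), §3 (3.2)–(3.8); Salmhofer 1998 §3.1):

* §1 linearity of `torusFourierInv` (`_add`, `_sub`, `_const_mul`, `_finset_sum`) and the weighted `ℓ¹` bound of a linear combination
  `sum_mul_norm_torusFourierInv_sum_le`;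
* §2 **`torusFourierInv_mul`** — the inverse transform of a pointwise product is the CONVOLUTION of the inverse transforms
  (`(fg)ˇ(x) = Σ_y f̌(y)·ǧ(x − y)`, exact on the finite torus);
* §3 **`sum_mul_norm_conv_le`** — for a non-negative SUBMULTIPLICATIVE weight (`w(x+y) ≤ w(x)·w(y)`):
  `Σ_x w(x)‖Σ_y F(y)G(x−y)‖ ≤ (Σ_x w‖F‖)(Σ_x w‖G‖)`, hence **`sum_mul_norm_torusFourierInv_mul_le`** (`M_w((fg)ˇ) ≤ M_w(f̌)·M_w(ǧ)`) and the
  square form `sum_mul_norm_torusFourierInv_mul_sq_le`;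
* §4 the MOMENT weights `(1 + Σ_i |x̃_i|)^r` (`x̃_i = ZMod.valMinAbs`, the centred representative) are non-negative, even and submultiplicative
  (`ZMod.natAbs_valMinAbs_add_le`): `one_add_sum_natAbs_valMinAbs_add_le`, `momentWeight_pow_add_le`, `…_neg`;
* §5 real parts: `torusChar_re_eq_cos_valMinAbs` (`Re χ_k(x) = cos(Σ_i p_i x̃_i)`, the CENTRED representative may replace `val`),
  `torusChar_add_torusChar_neg` (`χ_k(x) + χ_k(−x) = 2cos(…)`), and **`norm_cosCoeff_re_le`**: the cosine coefficient of the REAL PART of complex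
  data, `L^{-d}Σ_k Re f(k)·cos(p_k·x̃)`, is bounded by `(‖f̌(x)‖ + ‖f̌(−x)‖)/2`, so its even-weighted moments are `≤ Σ_x w‖f̌‖`
  (`sum_mul_abs_cosCoeff_re_le`).

Everything is proved; no definitions; no named facts.

## Sources

S. Friedli, Y. Velenik, *Statistical Mechanics of Lattice Systems* (2017), §10.4 (`FriedliVelenik2017`); G. Benfatto, A. Giuliani,
V. Mastropietro, Ann. Henri Poincaré 7 (2006) 809–898, §2.1 (2.36aa), §3 (3.2)–(3.8) (`BenfattoGiulianiMastropietro2006`).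
-/

noncomputable section

open Finset Complex
open scoped ComplexConjugate

namespace Literature.Probability.LatticeModels

variable {d L : ℕ} [NeZero L]

/-! ### §1 Linearity of the inverse transform and linear combinations under a weighted `ℓ¹` norm -/

/-- `(f + g)ˇ = f̌ + ǧ` (linearity of the inverse transform). [cite: FriedliVelenik2017, §10.4] -/
theorem torusFourierInv_add (f g : TorusSite d L → ℂ) (x : TorusSite d L) :
    torusFourierInv (fun k => f k + g k) x = torusFourierInv f x + torusFourierInv g x := by
  simp only [torusFourierInv_eq_sum_torusChar, add_mul, sum_add_distrib, mul_add]

/-- `(f − g)ˇ = f̌ − ǧ`. [cite: FriedliVelenik2017, §10.4] -/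
theorem torusFourierInv_sub (f g : TorusSite d L → ℂ) (x : TorusSite d L) :
    torusFourierInv (fun k => f k - g k) x = torusFourierInv f x - torusFourierInv g x := by
  simp only [torusFourierInv_eq_sum_torusChar, sub_mul, sum_sub_distrib, mul_sub]

/-- `(c·f)ˇ = c·f̌`. [cite: FriedliVelenik2017, §10.4] -/
theorem torusFourierInv_const_mul (c : ℂ) (f : TorusSite d L → ℂ) (x : TorusSite d L) :
    torusFourierInv (fun k => c * f k) x = c * torusFourierInv f x := by
  simp only [torusFourierInv_eq_sum_torusChar, mul_assoc, ← mul_sum]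
  ring

/-- `(Σ_a F_a)ˇ = Σ_a F̌_a`. [cite: FriedliVelenik2017, §10.4] -/
theorem torusFourierInv_finset_sum {ι : Type*} (s : Finset ι) (F : ι → TorusSite d L → ℂ) (x : TorusSite d L) :
    torusFourierInv (fun k => ∑ a ∈ s, F a k) x = ∑ a ∈ s, torusFourierInv (F a) x := by
  simp only [torusFourierInv_eq_sum_torusChar, sum_mul, mul_sum]
  rw [sum_comm]

/-- **Weighted `ℓ¹` bound of a linear combination**: for `w ≥ 0`,
`Σ_x w(x)‖(Σ_a c_a F_a)ˇ(x)‖ ≤ Σ_a ‖c_a‖·(Σ_x w(x)‖F̌_a(x)‖)`. [cite: BenfattoGiulianiMastropietro2006, §2.1 (2.36aa)] -/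
theorem sum_mul_norm_torusFourierInv_sum_le {ι : Type*} (s : Finset ι) (c : ι → ℂ) (F : ι → TorusSite d L → ℂ)
    {w : TorusSite d L → ℝ} (hw0 : ∀ x, 0 ≤ w x) :
    ∑ x, w x * ‖torusFourierInv (fun k => ∑ a ∈ s, c a * F a k) x‖ ≤
      ∑ a ∈ s, ‖c a‖ * ∑ x, w x * ‖torusFourierInv (F a) x‖ := by
  have h1 : ∀ x, torusFourierInv (fun k => ∑ a ∈ s, c a * F a k) x = ∑ a ∈ s, c a * torusFourierInv (F a) x := by
    intro x
    rw [torusFourierInv_finset_sum]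
    exact sum_congr rfl fun a _ => torusFourierInv_const_mul (c a) (F a) x
  calc ∑ x, w x * ‖torusFourierInv (fun k => ∑ a ∈ s, c a * F a k) x‖
      ≤ ∑ x, w x * ∑ a ∈ s, ‖c a‖ * ‖torusFourierInv (F a) x‖ := by
        refine sum_le_sum fun x _ => mul_le_mul_of_nonneg_left ?_ (hw0 x)
        rw [h1]
        exact (norm_sum_le _ _).trans (le_of_eq (sum_congr rfl fun a _ => norm_mul _ _))
    _ = ∑ x, ∑ a ∈ s, ‖c a‖ * (w x * ‖torusFourierInv (F a) x‖) := by
        refine sum_congr rfl fun x _ => ?_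
        rw [mul_sum]
        exact sum_congr rfl fun a _ => by ring
    _ = ∑ a ∈ s, ‖c a‖ * ∑ x, w x * ‖torusFourierInv (F a) x‖ := by
        rw [sum_comm]
        exact sum_congr rfl fun a _ => by rw [mul_sum]

/-- **Uniform form**: if every `Σ_x w‖F̌_a‖ ≤ N`, then `Σ_x w‖(Σ_a c_a F_a)ˇ‖ ≤ (Σ_a ‖c_a‖)·N`. [cite: BenfattoGiulianiMastropietro2006, §2.1 (2.36aa)] -/
theorem sum_mul_norm_torusFourierInv_sum_le_of_le {ι : Type*} (s : Finset ι) (c : ι → ℂ) (F : ι → TorusSite d L → ℂ)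
    {w : TorusSite d L → ℝ} (hw0 : ∀ x, 0 ≤ w x) {N : ℝ} (hN : ∀ a ∈ s, ∑ x, w x * ‖torusFourierInv (F a) x‖ ≤ N) :
    ∑ x, w x * ‖torusFourierInv (fun k => ∑ a ∈ s, c a * F a k) x‖ ≤ (∑ a ∈ s, ‖c a‖) * N := by
  refine (sum_mul_norm_torusFourierInv_sum_le s c F hw0).trans ?_
  rw [sum_mul]
  exact sum_le_sum fun a ha => mul_le_mul_of_nonneg_left (hN a ha) (norm_nonneg _)

/-! ### §2 Product ↦ convolution -/

/-- `χ_k(y)·conj χ_{k′}(y) = χ_{k−k′}(y)` (characters form a group). [cite: FriedliVelenik2017, §10.4] -/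
theorem torusChar_mul_conj_torusChar (k k' y : TorusSite d L) :
    torusChar k y * conj (torusChar k' y) = torusChar (k - k') y := by
  rw [torusChar_sub_left]

/-- **The inverse transform of a product is the convolution of the inverse transforms** (finite torus, exact):
`(f·g)ˇ(x) = Σ_y f̌(y)·ǧ(x − y)`. [cite: FriedliVelenik2017, §10.4] -/
theorem torusFourierInv_mul (f g : TorusSite d L → ℂ) (x : TorusSite d L) :
    torusFourierInv (fun k => f k * g k) x = ∑ y, torusFourierInv f y * torusFourierInv g (x - y) := by
  classical
  set c : ℂ := ((L : ℂ) ^ d)⁻¹ with hc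
  have hcL : c * (L : ℂ) ^ d = 1 := by rw [hc, inv_mul_cancel₀ natCast_pow_ne_zero]
  -- expand the right-hand side
  have hR : ∀ y, torusFourierInv f y * torusFourierInv g (x - y) =
      c * c * ∑ k, ∑ k', f k * g k' * torusChar k' x * (torusChar k y * conj (torusChar k' y)) := by
    intro y
    rw [torusFourierInv_eq_sum_torusChar, torusFourierInv_eq_sum_torusChar, ← hc]
    rw [show c * (∑ k, f k * torusChar k y) * (c * ∑ k', g k' * torusChar k' (x - y)) =
        c * c * ((∑ k, f k * torusChar k y) * ∑ k', g k' * torusChar k' (x - y)) by ring]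
    congr 1
    rw [sum_mul]
    refine sum_congr rfl fun k _ => ?_
    rw [mul_sum]
    refine sum_congr rfl fun k' _ => ?_
    rw [torusChar_sub_right]
    ring
  simp_rw [hR]
  rw [← mul_sum, sum_comm]
  -- the `y`-sum is the orthogonality relation
  have hin : ∀ k, ∑ y, ∑ k', f k * g k' * torusChar k' x * (torusChar k y * conj (torusChar k' y)) =
      f k * g k * torusChar k x * (L : ℂ) ^ d := by
    intro k
    rw [sum_comm]
    have h2 : ∀ k', ∑ y, f k * g k' * torusChar k' x * (torusChar k y * conj (torusChar k' y)) =
        f k * g k' * torusChar k' x * (if k - k' = 0 then (L : ℂ) ^ d else 0) := by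
      intro k'
      rw [← mul_sum]
      congr 1
      simp_rw [torusChar_mul_conj_torusChar]
      exact sum_torusChar_right (k - k')
    simp_rw [h2, sub_eq_zero, mul_ite, mul_zero]
    rw [Finset.sum_ite_eq]
    simp
  simp_rw [hin]
  rw [torusFourierInv_eq_sum_torusChar, ← hc, mul_sum, mul_sum]
  refine sum_congr rfl fun k _ => ?_
  calc c * (f k * g k * torusChar k x) = c * (c * (L : ℂ) ^ d) * (f k * g k * torusChar k x) := by rw [hcL, mul_one]
    _ = c * c * (f k * g k * torusChar k x * (L : ℂ) ^ d) := by ring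

/-! ### §3 Weighted `ℓ¹` norms: the convolution inequality for a submultiplicative weight -/

/-- **Weighted Young inequality on the torus**: for `w ≥ 0` with `w(x + y) ≤ w(x)·w(y)`,
`Σ_x w(x)‖Σ_y F(y)G(x − y)‖ ≤ (Σ_x w(x)‖F(x)‖)·(Σ_x w(x)‖G(x)‖)`. [cite: BenfattoGiulianiMastropietro2006, §3 (3.3)] -/
theorem sum_mul_norm_conv_le {w : TorusSite d L → ℝ} (hw0 : ∀ x, 0 ≤ w x) (hw : ∀ x y, w (x + y) ≤ w x * w y)
    (F G : TorusSite d L → ℂ) :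
    ∑ x, w x * ‖∑ y, F y * G (x - y)‖ ≤ (∑ x, w x * ‖F x‖) * (∑ x, w x * ‖G x‖) := by
  calc ∑ x, w x * ‖∑ y, F y * G (x - y)‖
      ≤ ∑ x, ∑ y, w y * ‖F y‖ * (w (x - y) * ‖G (x - y)‖) := by
        refine sum_le_sum fun x _ => ?_
        calc w x * ‖∑ y, F y * G (x - y)‖ ≤ w x * ∑ y, ‖F y‖ * ‖G (x - y)‖ :=
              mul_le_mul_of_nonneg_left ((norm_sum_le _ _).trans (le_of_eq (sum_congr rfl fun y _ => norm_mul _ _))) (hw0 x)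
          _ = ∑ y, w x * (‖F y‖ * ‖G (x - y)‖) := by rw [mul_sum]
          _ ≤ ∑ y, w y * ‖F y‖ * (w (x - y) * ‖G (x - y)‖) := sum_le_sum fun y _ => by
              have hxy : w x ≤ w y * w (x - y) := by
                have h := hw y (x - y); rwa [add_sub_cancel] at h
              calc w x * (‖F y‖ * ‖G (x - y)‖) ≤ w y * w (x - y) * (‖F y‖ * ‖G (x - y)‖) :=
                    mul_le_mul_of_nonneg_right hxy (by positivity)
                _ = w y * ‖F y‖ * (w (x - y) * ‖G (x - y)‖) := by ring
    _ = ∑ y, w y * ‖F y‖ * ∑ x, w (x - y) * ‖G (x - y)‖ := by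
        rw [sum_comm]
        exact sum_congr rfl fun y _ => by rw [mul_sum]
    _ = ∑ y, w y * ‖F y‖ * ∑ x, w x * ‖G x‖ := by
        refine sum_congr rfl fun y _ => ?_
        congr 1
        exact Fintype.sum_equiv (Equiv.subRight y) _ _ fun x => rfl
    _ = (∑ x, w x * ‖F x‖) * (∑ x, w x * ‖G x‖) := by rw [sum_mul]

/-- **Moments of a product**: `Σ_x w‖(fg)ˇ‖ ≤ (Σ_x w‖f̌‖)·(Σ_x w‖ǧ‖)` for a non-negative submultiplicative weight.
[cite: BenfattoGiulianiMastropietro2006, §3 (3.3)] -/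
theorem sum_mul_norm_torusFourierInv_mul_le {w : TorusSite d L → ℝ} (hw0 : ∀ x, 0 ≤ w x) (hw : ∀ x y, w (x + y) ≤ w x * w y)
    (f g : TorusSite d L → ℂ) :
    ∑ x, w x * ‖torusFourierInv (fun k => f k * g k) x‖ ≤
      (∑ x, w x * ‖torusFourierInv f x‖) * (∑ x, w x * ‖torusFourierInv g x‖) := by
  simp_rw [torusFourierInv_mul f g]
  exact sum_mul_norm_conv_le hw0 hw _ _

/-- **Moments of `f·g²`**: `Σ_x w‖(f·g²)ˇ‖ ≤ (Σ_x w‖f̌‖)·(Σ_x w‖ǧ‖)²`. [cite: BenfattoGiulianiMastropietro2006, §3 (3.3)] -/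
theorem sum_mul_norm_torusFourierInv_mul_sq_le {w : TorusSite d L → ℝ} (hw0 : ∀ x, 0 ≤ w x) (hw : ∀ x y, w (x + y) ≤ w x * w y)
    (f g : TorusSite d L → ℂ) :
    ∑ x, w x * ‖torusFourierInv (fun k => f k * g k ^ 2) x‖ ≤
      (∑ x, w x * ‖torusFourierInv f x‖) * (∑ x, w x * ‖torusFourierInv g x‖) ^ 2 := by
  have h1 : (fun k => f k * g k ^ 2) = fun k => (f k * g k) * g k := by funext k; ring
  rw [h1]
  refine (sum_mul_norm_torusFourierInv_mul_le hw0 hw _ g).trans ?_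
  have hg0 : 0 ≤ ∑ x, w x * ‖torusFourierInv g x‖ := sum_nonneg fun x _ => mul_nonneg (hw0 x) (norm_nonneg _)
  calc (∑ x, w x * ‖torusFourierInv (fun k => f k * g k) x‖) * ∑ x, w x * ‖torusFourierInv g x‖
      ≤ (∑ x, w x * ‖torusFourierInv f x‖) * (∑ x, w x * ‖torusFourierInv g x‖) * ∑ x, w x * ‖torusFourierInv g x‖ :=
        mul_le_mul_of_nonneg_right (sum_mul_norm_torusFourierInv_mul_le hw0 hw f g) hg0
    _ = (∑ x, w x * ‖torusFourierInv f x‖) * (∑ x, w x * ‖torusFourierInv g x‖) ^ 2 := by ring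

/-! ### §4 The moment weights `(1 + Σ_i |x̃_i|)^r` -/

omit [NeZero L] in
/-- `|(x + y)~_i| ≤ |x̃_i| + |ỹ_i|` coordinatewise (the centred representative minimises the absolute value).
[cite: FriedliVelenik2017, §10.4] -/
theorem natAbs_valMinAbs_add_apply_le (x y : TorusSite d L) (i : Fin d) :
    (((x + y) i).valMinAbs.natAbs : ℝ) ≤ ((x i).valMinAbs.natAbs : ℝ) + ((y i).valMinAbs.natAbs : ℝ) := by
  have h := ZMod.natAbs_valMinAbs_add_le (x i) (y i)
  have h2 : ((x i).valMinAbs + (y i).valMinAbs).natAbs ≤ (x i).valMinAbs.natAbs + (y i).valMinAbs.natAbs :=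
    Int.natAbs_add_le _ _
  rw [Pi.add_apply]
  exact_mod_cast h.trans h2

omit [NeZero L] in
/-- **Submultiplicativity of the linear moment weight**: `1 + Σ_i |(x+y)~_i| ≤ (1 + Σ_i |x̃_i|)·(1 + Σ_i |ỹ_i|)`.
[cite: BenfattoGiulianiMastropietro2006, §3 (3.3)] -/
theorem one_add_sum_natAbs_valMinAbs_add_le (x y : TorusSite d L) :
    1 + ∑ i, (((x + y) i).valMinAbs.natAbs : ℝ) ≤
      (1 + ∑ i, ((x i).valMinAbs.natAbs : ℝ)) * (1 + ∑ i, ((y i).valMinAbs.natAbs : ℝ)) := by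
  have hX : 0 ≤ ∑ i, ((x i).valMinAbs.natAbs : ℝ) := sum_nonneg fun i _ => Nat.cast_nonneg _
  have hY : 0 ≤ ∑ i, ((y i).valMinAbs.natAbs : ℝ) := sum_nonneg fun i _ => Nat.cast_nonneg _
  have h1 : ∑ i, (((x + y) i).valMinAbs.natAbs : ℝ) ≤ ∑ i, ((x i).valMinAbs.natAbs : ℝ) + ∑ i, ((y i).valMinAbs.natAbs : ℝ) := by
    rw [← sum_add_distrib]
    exact sum_le_sum fun i _ => natAbs_valMinAbs_add_apply_le x y i
  nlinarith [mul_nonneg hX hY]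

omit [NeZero L] in
/-- **Submultiplicativity of the moment weight of order `r`**: `(1 + Σ_i |(x+y)~_i|)^r ≤ (1 + Σ_i |x̃_i|)^r·(1 + Σ_i |ỹ_i|)^r`.
[cite: BenfattoGiulianiMastropietro2006, §3 (3.3)] -/
theorem momentWeight_pow_add_le (r : ℕ) (x y : TorusSite d L) :
    (1 + ∑ i, (((x + y) i).valMinAbs.natAbs : ℝ)) ^ r ≤
      (1 + ∑ i, ((x i).valMinAbs.natAbs : ℝ)) ^ r * (1 + ∑ i, ((y i).valMinAbs.natAbs : ℝ)) ^ r := by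
  rw [← mul_pow]
  exact pow_le_pow_left₀ (by positivity) (one_add_sum_natAbs_valMinAbs_add_le x y) r

omit [NeZero L] in
/-- The moment weight is non-negative. [cite: BenfattoGiulianiMastropietro2006, §3 (3.3)] -/
theorem momentWeight_pow_nonneg (r : ℕ) (x : TorusSite d L) : 0 ≤ (1 + ∑ i, ((x i).valMinAbs.natAbs : ℝ)) ^ r := by
  positivity

omit [NeZero L] in
/-- The moment weight is even. [cite: BenfattoGiulianiMastropietro2006, §3 (3.3)] -/
theorem momentWeight_pow_neg (r : ℕ) (x : TorusSite d L) :
    (1 + ∑ i, (((-x) i).valMinAbs.natAbs : ℝ)) ^ r = (1 + ∑ i, ((x i).valMinAbs.natAbs : ℝ)) ^ r := by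
  simp only [Pi.neg_apply, ZMod.natAbs_valMinAbs_neg]

omit [NeZero L] in
/-- The two-dimensional moment weight in the split form `(1 + |x̃₀| + |x̃₁|)^r` is submultiplicative.
[cite: BenfattoGiulianiMastropietro2006, §3 (3.3)] -/
theorem momentWeight₂_pow_add_le (r : ℕ) (x y : TorusSite 2 L) :
    (1 + (((x + y) 0).valMinAbs.natAbs : ℝ) + (((x + y) 1).valMinAbs.natAbs : ℝ)) ^ r ≤
      (1 + ((x 0).valMinAbs.natAbs : ℝ) + ((x 1).valMinAbs.natAbs : ℝ)) ^ r *
        (1 + ((y 0).valMinAbs.natAbs : ℝ) + ((y 1).valMinAbs.natAbs : ℝ)) ^ r := by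
  have h := momentWeight_pow_add_le r x y
  simp only [Fin.sum_univ_two, ← add_assoc] at h
  exact h

omit [NeZero L] in
/-- The two-dimensional moment weight is even. [cite: BenfattoGiulianiMastropietro2006, §3 (3.3)] -/
theorem momentWeight₂_pow_neg (r : ℕ) (x : TorusSite 2 L) :
    (1 + (((-x) 0).valMinAbs.natAbs : ℝ) + (((-x) 1).valMinAbs.natAbs : ℝ)) ^ r =
      (1 + ((x 0).valMinAbs.natAbs : ℝ) + ((x 1).valMinAbs.natAbs : ℝ)) ^ r := by
  simp only [Pi.neg_apply, ZMod.natAbs_valMinAbs_neg]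

/-! ### §5 Real parts: the cosine coefficients of the real part of complex data -/

/-- **`Re χ_k(x) = cos(Σ_i p_i·x̃_i)` with the CENTRED representative `x̃_i`** (it differs from `val` by a multiple of `L`, and
`p_i·L = 2π·k_i.val ∈ 2πℤ`). [cite: FriedliVelenik2017, §10.4] -/
theorem torusChar_re_eq_cos_valMinAbs (k x : TorusSite d L) :
    (torusChar k x).re = Real.cos (∑ i, latticeMomentum L k i * ((x i).valMinAbs : ℝ)) := by
  rw [torusChar_re]
  -- per coordinate the two phases differ by an integer multiple of `2π`
  have hL : (L : ℝ) ≠ 0 := Nat.cast_ne_zero.2 (NeZero.ne L)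
  have hi : ∀ i, ∃ m : ℤ, latticeMomentum L k i * ((x i).val : ℝ) =
      latticeMomentum L k i * ((x i).valMinAbs : ℝ) + (m : ℝ) * (2 * Real.pi) := by
    intro i
    -- `val - valMinAbs ∈ Lℤ`
    have hdvd : (L : ℤ) ∣ ((x i).val : ℤ) - (x i).valMinAbs := by
      rw [← ZMod.intCast_zmod_eq_zero_iff_dvd]
      push_cast
      simp
    obtain ⟨m, hm⟩ := hdvd
    refine ⟨((k i).val : ℤ) * m, ?_⟩
    have hm' : ((x i).val : ℝ) = ((x i).valMinAbs : ℝ) + (L : ℝ) * (m : ℝ) := by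
      have := congrArg (fun z : ℤ => (z : ℝ)) hm
      push_cast at this
      linarith
    have hkey : latticeMomentum L k i * ((L : ℝ) * (m : ℝ)) = ((((k i).val : ℤ) * m : ℤ) : ℝ) * (2 * Real.pi) := by
      unfold latticeMomentum
      push_cast
      calc 2 * Real.pi * ((k i).val : ℝ) / L * ((L : ℝ) * (m : ℝ)) = (2 * Real.pi * ((k i).val : ℝ) / L * L) * m := by ring
        _ = 2 * Real.pi * ((k i).val : ℝ) * m := by rw [div_mul_cancel₀ _ hL]
        _ = ((k i).val : ℝ) * (m : ℝ) * (2 * Real.pi) := by ring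
    rw [hm', mul_add, hkey]
  choose m hm using hi
  simp_rw [hm]
  rw [sum_add_distrib, ← sum_mul, show (∑ i, (m i : ℝ)) = ((∑ i, m i : ℤ) : ℝ) by push_cast; rfl,
    Real.cos_add_int_mul_two_pi]

/-- `χ_k(x) + χ_k(−x) = 2·cos(Σ_i p_i x̃_i)`. [cite: FriedliVelenik2017, §10.4] -/
theorem torusChar_add_torusChar_neg (k x : TorusSite d L) :
    torusChar k x + torusChar k (-x) = 2 * (Real.cos (∑ i, latticeMomentum L k i * ((x i).valMinAbs : ℝ)) : ℂ) := by
  rw [torusChar_neg_right, Complex.add_conj, ← torusChar_re_eq_cos_valMinAbs]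
  push_cast
  ring

/-- **The cosine coefficient of the real part of complex data is a symmetrised inverse transform**:
`L^{-d}·Σ_k Re f(k)·cos(p_k·x̃) = Re((f̌(x) + f̌(−x))/2)`. [cite: FriedliVelenik2017, §10.4] -/
theorem cosCoeff_re_eq (f : TorusSite d L → ℂ) (x : TorusSite d L) :
    ((L : ℝ) ^ d)⁻¹ * ∑ k, (f k).re * Real.cos (∑ i, latticeMomentum L k i * ((x i).valMinAbs : ℝ)) =
      ((torusFourierInv f x + torusFourierInv f (-x)) / 2).re := by
  rw [torusFourierInv_eq_sum_torusChar, torusFourierInv_eq_sum_torusChar, ← mul_add, ← sum_add_distrib]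
  simp_rw [← mul_add, torusChar_add_torusChar_neg]
  have h1 : ((L : ℂ) ^ d)⁻¹ * (∑ k, f k * (2 * (Real.cos (∑ i, latticeMomentum L k i * ((x i).valMinAbs : ℝ)) : ℂ))) / 2 =
      ∑ k, ((((L : ℝ) ^ d)⁻¹ : ℝ) : ℂ) * (f k * (Real.cos (∑ i, latticeMomentum L k i * ((x i).valMinAbs : ℝ)) : ℂ)) := by
    rw [mul_sum, sum_div]
    refine sum_congr rfl fun k _ => ?_
    push_cast
    ring
  rw [h1, Complex.re_sum, mul_sum]
  refine sum_congr rfl fun k _ => ?_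
  rw [Complex.re_ofReal_mul, Complex.mul_re, Complex.ofReal_re, Complex.ofReal_im, mul_zero, sub_zero]

/-- **Pointwise bound**: `|L^{-d}·Σ_k Re f(k)·cos(p_k·x̃)| ≤ (‖f̌(x)‖ + ‖f̌(−x)‖)/2`. [cite: BenfattoGiulianiMastropietro2006, §2.1 (2.36aa)] -/
theorem norm_cosCoeff_re_le (f : TorusSite d L → ℂ) (x : TorusSite d L) :
    |((L : ℝ) ^ d)⁻¹ * ∑ k, (f k).re * Real.cos (∑ i, latticeMomentum L k i * ((x i).valMinAbs : ℝ))| ≤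
      (‖torusFourierInv f x‖ + ‖torusFourierInv f (-x)‖) / 2 := by
  rw [cosCoeff_re_eq]
  refine (Complex.abs_re_le_norm _).trans ?_
  rw [norm_div, RCLike.norm_ofNat]
  exact div_le_div_of_nonneg_right (norm_add_le _ _) zero_le_two

/-- **Even-weighted moments of the cosine coefficients of a real part are bounded by those of the inverse transform**:
for `w ≥ 0` even, `Σ_x w(x)|L^{-d}Σ_k Re f(k)cos(p_k·x̃)| ≤ Σ_x w(x)‖f̌(x)‖`. [cite: BenfattoGiulianiMastropietro2006, §2.1 (2.36aa)] -/
theorem sum_mul_abs_cosCoeff_re_le (f : TorusSite d L → ℂ) {w : TorusSite d L → ℝ} (hw0 : ∀ x, 0 ≤ w x)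
    (hwe : ∀ x, w (-x) = w x) :
    ∑ x, w x * |((L : ℝ) ^ d)⁻¹ * ∑ k, (f k).re * Real.cos (∑ i, latticeMomentum L k i * ((x i).valMinAbs : ℝ))| ≤
      ∑ x, w x * ‖torusFourierInv f x‖ := by
  calc ∑ x, w x * |((L : ℝ) ^ d)⁻¹ * ∑ k, (f k).re * Real.cos (∑ i, latticeMomentum L k i * ((x i).valMinAbs : ℝ))|
      ≤ ∑ x, w x * ((‖torusFourierInv f x‖ + ‖torusFourierInv f (-x)‖) / 2) :=
        sum_le_sum fun x _ => mul_le_mul_of_nonneg_left (norm_cosCoeff_re_le f x) (hw0 x)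
    _ = ((∑ x, w x * ‖torusFourierInv f x‖) + ∑ x, w (-x) * ‖torusFourierInv f (-x)‖) / 2 := by
        rw [← sum_add_distrib, sum_div]
        refine sum_congr rfl fun x _ => ?_
        rw [hwe]; ring
    _ = ∑ x, w x * ‖torusFourierInv f x‖ := by
        rw [show (∑ x, w (-x) * ‖torusFourierInv f (-x)‖) = ∑ x, w x * ‖torusFourierInv f x‖ from
          Fintype.sum_equiv (Equiv.neg _) _ _ fun x => rfl]
        ring

end Literature.Probability.LatticeModels

end
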